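import Literature.NumberTheory.Automorphic.UnitaryUnitOrbitalIntegralFixedPoints   -- ★ `classOrbitalIntegral_indicator_eq_card_fixedBy` (ν(K) = 1 form), the `G′_v` socket lemmas (`isRegularElt_val_conj`, `isClosed_conjClass_local_of_isRegularElt`)
import HarnessLib

/-!
# The unit orbital integral of ANY compact open subgroup at an elliptic class is `ν(C) · #Fix_γ(G ⧸ C)` — the volume-weighted fixed-point reading for the Euler–Poincaré function
# (Kottwitz 1988 §2; Laumon 1996 Lemma (5.3.2); Rogawski 1990 §4.9 p. 54)

Topic `NumberTheory/Automorphic`; namespace `Literature.NumberTheory.Automorphic`.  THEOREMS ONLY (no definition, no instance, no notation, no named fact, no `sorry`).  Cell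
`pub/hodgecm-mathlib` (D-0151), crux H413 = `stmt-HodgeConjecture-24833`, floor-2 line «N6nsGerm», stub `stub_N6nsR2EP : RankOneEulerPoincareNonsplit` (★-def B-p08 p841621, (R2) =
Kottwitz's Euler–Poincaré function on `U(Φ₂)_v`); LEAD F0P3a-plan (g9) WORD T8-167 (census `B-provers/B-p04/g34/CENSUS-R2EP-RankOneEulerPoincare.B-p04g34.md` adopted: B-p04 = EP pen),
BRICK (1) «the `C`-generic fixed-point reading»; seat B-p04 (g34).  HONEST LABEL: HC_CM is proved only modulo the printed citations until rung 0 closes; this file pays no printed letter.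

THE MATHEMATICS.  For `f_EP := ν(K)⁻¹𝟙_K + ν(K′)⁻¹𝟙_{K′} − ν(I)⁻¹𝟙_I` one needs the unit orbital integral of THREE different compact open subgroups under ONE canonical family `m` (whose
Haar measure `ν` cannot give all three mass one).  ★ `classOrbitalIntegral_indicator_eq_card_fixedBy` (F0P3a-p04) is the `ν(K) = 1` case; its engine ★
`orbitalIntegral_indicator_quotientMeasure_eq_card_mul` already carries the factor `ν(K) ∕ t(C_G(γ))`.  Here: for `m` CANONICAL for `(P, ν)`, `P` conjugation-invariant with `P γ`,
`C_G(γ)` COMPACT (so the canonical torus measure has TOTAL mass one) and the class of `γ` closed, and ANY compact open subgroup `C`: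
**`Φ(⟦γ⟧, 𝟙_C; m) = #Fix_γ(G ⧸ C) · ν(C)`** (§1, real and complex indicators), hence `Φ(⟦γ⟧, ν(C)⁻¹·𝟙_C; m) = #Fix_γ(G ⧸ C)` — read on the CM carrier
`U₂ = U(Φ₂)(L⁺_v)` (and on any `U(H)(L⁺_v)`) for regular `γ` with compact centraliser (§2), where the class is closed (★ `isClosed_conjClass_local_of_isRegularElt`).

References: [Kottwitz1988] §2 Thm. 2 · [Laumon1995] Lemma (5.3.2) p. 136 · [Rogawski1990] §4.3 p. 43, §4.9 p. 54 · [Kottwitz1986] §3.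
-/

set_option autoImplicit false

noncomputable section

open MeasureTheory Measure Topology Filter Set NumberField IsDedekindDomain
open scoped ENNReal NNReal Matrix MatrixGroups

namespace Literature.NumberTheory.Automorphic

open Literature.MeasureTheory.Group
open Literature.NumberTheory.Rogawski1990 (IsRegularElt)

/-! ## §1 Generic: any compact open subgroup, elliptic class -/

section Generic

variable {G : Type*} [Group G] [TopologicalSpace G] [IsTopologicalGroup G] [LocallyCompactSpace G] [SecondCountableTopology G] [T2Space G]
  [MeasurableSpace G] [BorelSpace G]
  [∀ γ : G, MeasurableSpace (G ⧸ Subgroup.centralizer ({γ} : Set G))]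
  [∀ γ : G, BorelSpace (G ⧸ Subgroup.centralizer ({γ} : Set G))]

/-- **`Φ(⟦γ⟧, 𝟙_C; m) = #Fix_γ(G ⧸ C) · ν(C)`** (real indicator) for `m` canonical for `(P, ν)`, `P γ`, `C_G(γ)` compact, the class of `γ` closed, `C` ANY compact open subgroup —
★ `classOrbitalIntegral_indicator_eq_card_fixedBy` without the normalisation `ν(C) = 1`. [cite: Laumon1995, Lemma (5.3.2) p. 136] [cite: Rogawski1990, §4.9 p. 54] [cite: Kottwitz1988, §2] -/
theorem classOrbitalIntegral_indicator_eq_card_fixedBy_mul {P : G → Prop} (hP : ∀ g x : G, P g → P (x * g * x⁻¹))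
    {ν : Measure G} [ν.IsHaarMeasure] [ν.IsMulRightInvariant] {m : OrbitalMeasureFamily G} (hm : m.IsCanonical P ν)
    {γ : G} (hγ : P γ) [CompactSpace (Subgroup.centralizer ({γ} : Set G))] (C : Subgroup G) (hC : IsOpen (C : Set G))
    (hCc : IsCompact (C : Set G)) (hO : IsClosed {g | ∃ y : G, y * γ * y⁻¹ = g}) :
    classOrbitalIntegral m ((C : Set G).indicator (1 : G → ℝ)) (ConjClasses.mk γ) =
      (Nat.card (MulAction.fixedBy (G ⧸ C) γ) : ℝ) * (ν C).toReal := by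
  haveI : BorelSpace (Subgroup.centralizer ({γ} : Set G)) := Subtype.borelSpace _
  let K₀ : TopologicalSpace.PositiveCompacts (Subgroup.centralizer ({γ} : Set G)) :=
    ⟨⟨Set.univ, isCompact_univ⟩, by rw [interior_univ]; exact univ_nonempty⟩
  haveI : (haarMeasure K₀).IsInvInvariant := isInvInvariant_of_compactSpace _
  have h1 : haarMeasure K₀ Set.univ = 1 := haarMeasure_self
  have hcore : haarMeasure K₀ (compactCore (Subgroup.centralizer ({γ} : Set G))) = 1 := by
    rw [compactCore_eq_univ]; exact h1
  haveI : IsClosed ((Subgroup.centralizer ({γ} : Set G) : Subgroup G) : Set G) := isClosed_coe_centralizer_singleton γ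
  rw [hm.classOrbitalIntegral_mk_eq_orbitalIntegral' hP hγ (haarMeasure K₀) hcore]
  have h := orbitalIntegral_indicator_quotientMeasure_eq_card_mul γ C (haarMeasure K₀) ν hC (finite_fixedBy_quotient_of_isClosed γ C hO hC hCc)
  rw [h1, div_one] at h
  exact h

/-- The same in the letters' `ℂ` currency: `Φ(⟦γ⟧, 𝟙_C; m) = #Fix_γ(G ⧸ C) · ν(C)`. [cite: Laumon1995, Lemma (5.3.2) p. 136] [cite: Kottwitz1988, §2] -/
theorem classOrbitalIntegral_indicator_complex_eq_natCard_fixedBy_mul {P : G → Prop} (hP : ∀ g x : G, P g → P (x * g * x⁻¹))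
    {ν : Measure G} [ν.IsHaarMeasure] [ν.IsMulRightInvariant] {m : OrbitalMeasureFamily G} (hm : m.IsCanonical P ν)
    {γ : G} (hγ : P γ) [CompactSpace (Subgroup.centralizer ({γ} : Set G))] (C : Subgroup G) (hC : IsOpen (C : Set G))
    (hCc : IsCompact (C : Set G)) (hO : IsClosed {g | ∃ y : G, y * γ * y⁻¹ = g}) :
    classOrbitalIntegral m ((C : Set G).indicator fun _ => (1 : ℂ)) (ConjClasses.mk γ) =
      (Nat.card (MulAction.fixedBy (G ⧸ C) γ) : ℂ) * ((ν C).toReal : ℂ) := by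
  rw [classOrbitalIntegral_indicator_complex_eq_ofReal, classOrbitalIntegral_indicator_eq_card_fixedBy_mul hP hm hγ C hC hCc hO,
    Complex.ofReal_mul, Complex.ofReal_natCast]

/-- **Volume-normalised form: `Φ(⟦γ⟧, ν(C)⁻¹·𝟙_C; m) = #Fix_γ(G ⧸ C)`** (`ν(C)` is finite and positive for a compact open subgroup) — the summand shape of the Euler–Poincaré
function. [cite: Kottwitz1988, §2 Theorem 2] [cite: Laumon1995, Lemma (5.3.2) p. 136] -/
theorem classOrbitalIntegral_smul_indicator_complex_eq_natCard_fixedBy {P : G → Prop} (hP : ∀ g x : G, P g → P (x * g * x⁻¹))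
    {ν : Measure G} [ν.IsHaarMeasure] [ν.IsMulRightInvariant] {m : OrbitalMeasureFamily G} (hm : m.IsCanonical P ν)
    {γ : G} (hγ : P γ) [CompactSpace (Subgroup.centralizer ({γ} : Set G))] (C : Subgroup G) (hC : IsOpen (C : Set G))
    (hCc : IsCompact (C : Set G)) (hO : IsClosed {g | ∃ y : G, y * γ * y⁻¹ = g}) :
    classOrbitalIntegral m (fun g => (((ν C).toReal : ℂ))⁻¹ * (C : Set G).indicator (fun _ => (1 : ℂ)) g) (ConjClasses.mk γ) =
      (Nat.card (MulAction.fixedBy (G ⧸ C) γ) : ℂ) := by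
  have hpos : 0 < (ν C).toReal := ENNReal.toReal_pos (hC.measure_pos ν ⟨1, C.one_mem⟩).ne' hCc.measure_lt_top.ne
  have hne : ((ν C).toReal : ℂ) ≠ 0 := Complex.ofReal_ne_zero.2 hpos.ne'
  have hfun : (fun g => (((ν C).toReal : ℂ))⁻¹ * (C : Set G).indicator (fun _ => (1 : ℂ)) g) = (((ν C).toReal : ℂ))⁻¹ • (C : Set G).indicator (fun _ => (1 : ℂ)) := by
    funext g; rw [Pi.smul_apply, smul_eq_mul]
  rw [hfun, classOrbitalIntegral_eq, orbitalIntegral_smul, ← classOrbitalIntegral_eq, classOrbitalIntegral_indicator_complex_eq_natCard_fixedBy_mul hP hm hγ C hC hCc hO,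
    smul_eq_mul, mul_comm, mul_assoc, mul_inv_cancel₀ hne, mul_one]

end Generic

/-! ## §2 On `U(H)(L⁺_v)` — in particular `U₂ = U(Φ₂)(L⁺_v)` — at a regular elliptic class -/

namespace UnitaryGroup

section CM

variable (L : Type) [Field L] [NumberField L] [IsCMField L] (N : ℕ) (H : Matrix (Fin N) (Fin N) L) (v : HeightOneSpectrum (𝓞 ↥(maximalRealSubfield L)))
  [MeasurableSpace ((cmDatum L N H).Local v)] [BorelSpace ((cmDatum L N H).Local v)]
  [∀ γ : (cmDatum L N H).Local v, MeasurableSpace ((cmDatum L N H).Local v ⧸ Subgroup.centralizer ({γ} : Set ((cmDatum L N H).Local v)))]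
  [∀ γ : (cmDatum L N H).Local v, BorelSpace ((cmDatum L N H).Local v ⧸ Subgroup.centralizer ({γ} : Set ((cmDatum L N H).Local v)))]
  (ν : Measure ((cmDatum L N H).Local v)) [IsHaarMeasure ν] [ν.IsMulRightInvariant]

/-- **`Φ(⟦γ⟧, 𝟙_C; m) = #Fix_γ(U(H)(L⁺_v) ⧸ C) · ν(C)` for EVERY compact open subgroup `C`** of `U(H)(L⁺_v)` (any rank, any hermitian `H` with `det H ≠ 0`, any finite `v`), `m` canonical
for `(IsRegularElt, ν)`, `γ` regular with COMPACT centraliser (class closed: ★ `isClosed_conjClass_local_of_isRegularElt`).  With `C = K, K′, I` this is the elliptic half of the Euler–Poincaré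
computation on `U₂`. [cite: Kottwitz1988, §2 Theorem 2] [cite: Rogawski1990, §4.9 p. 54; §4.3 (4.3.1) p. 43] [cite: Laumon1995, Lemma (5.3.2) p. 136] -/
theorem classOrbitalIntegral_indicator_complex_local_eq_natCard_fixedBy_mul (hH : (H.map (cmConjRingHom L))ᵀ = H) (hdet : H.det ≠ 0)
    {m : OrbitalMeasureFamily ((cmDatum L N H).Local v)} (hm : m.IsCanonical (fun γ => IsRegularElt (γ.val : GL (Fin N) (LocalRing L v))) ν)
    (C : Subgroup ((cmDatum L N H).Local v)) (hC : IsOpen (C : Set ((cmDatum L N H).Local v))) (hCc : IsCompact (C : Set ((cmDatum L N H).Local v)))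
    (γ : (cmDatum L N H).Local v) (hreg : IsRegularElt (γ.val : GL (Fin N) (LocalRing L v)))
    [CompactSpace (Subgroup.centralizer ({γ} : Set ((cmDatum L N H).Local v)))] :
    classOrbitalIntegral m ((C : Set ((cmDatum L N H).Local v)).indicator fun _ => (1 : ℂ)) (ConjClasses.mk γ) =
      (Nat.card (MulAction.fixedBy ((cmDatum L N H).Local v ⧸ C) γ) : ℂ) * ((ν C).toReal : ℂ) :=
  classOrbitalIntegral_indicator_complex_eq_natCard_fixedBy_mul (P := fun γ : (cmDatum L N H).Local v => IsRegularElt (γ.val : GL (Fin N) (LocalRing L v)))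
    (fun g x hg => isRegularElt_val_conj L N H v g x hg) hm hreg C hC hCc (isClosed_conjClass_local_of_isRegularElt L N H v hH hdet γ hreg)

/-- **`Φ(⟦γ⟧, ν(C)⁻¹·𝟙_C; m) = #Fix_γ(U(H)(L⁺_v) ⧸ C)`** — the volume-normalised summand of `f_EP` on `U(H)(L⁺_v)` at a regular elliptic class, any compact open subgroup `C`.
[cite: Kottwitz1988, §2 Theorem 2] [cite: Rogawski1990, §12.6 p. 174; §4.9 p. 54] -/
theorem classOrbitalIntegral_smul_indicator_complex_local_eq_natCard_fixedBy (hH : (H.map (cmConjRingHom L))ᵀ = H) (hdet : H.det ≠ 0)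
    {m : OrbitalMeasureFamily ((cmDatum L N H).Local v)} (hm : m.IsCanonical (fun γ => IsRegularElt (γ.val : GL (Fin N) (LocalRing L v))) ν)
    (C : Subgroup ((cmDatum L N H).Local v)) (hC : IsOpen (C : Set ((cmDatum L N H).Local v))) (hCc : IsCompact (C : Set ((cmDatum L N H).Local v)))
    (γ : (cmDatum L N H).Local v) (hreg : IsRegularElt (γ.val : GL (Fin N) (LocalRing L v)))
    [CompactSpace (Subgroup.centralizer ({γ} : Set ((cmDatum L N H).Local v)))] :
    classOrbitalIntegral m (fun g => (((ν C).toReal : ℂ))⁻¹ * (C : Set ((cmDatum L N H).Local v)).indicator (fun _ => (1 : ℂ)) g) (ConjClasses.mk γ) =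
      (Nat.card (MulAction.fixedBy ((cmDatum L N H).Local v ⧸ C) γ) : ℂ) :=
  classOrbitalIntegral_smul_indicator_complex_eq_natCard_fixedBy (P := fun γ : (cmDatum L N H).Local v => IsRegularElt (γ.val : GL (Fin N) (LocalRing L v)))
    (fun g x hg => isRegularElt_val_conj L N H v g x hg) hm hreg C hC hCc (isClosed_conjClass_local_of_isRegularElt L N H v hH hdet γ hreg)

end CM

end UnitaryGroup

end Literature.NumberTheory.Automorphic

end
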